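import Summits.MatrixMultiplication.OmegaCensus.DominoZ11StructSevenRows1
import HarnessLib

/-!
# Structural part-`7` route at `p = 11`: completeness rows `4`–`7` (rows file 2 of 2)

ω-census `pub-omega`, family (b3), seat pub-omega-group gen 24.  Framing: lottery ticket; floor = certified bounds/negative
ranges.  VALUE: per-prime kernel data of the STRUCTURAL part-`7` route (`DominoZpZpStructSeven*.lean`) for `p = 11` —
target: the OPEN census cells `(1,7,23)@484` ×2 (`A = ℤ₄ × ℤ₁₁²`, `ℤ₂² × ℤ₁₁²`) and every larger order; NOT progress on ω.

Rows `4`–`7` of `checkSevenRow 11 etZ11s7 tabTreeZ11s7` (`11⁴` lookups each); table, tree and the other rows in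
`DominoZ11StructSevenRows1.lean` and its siblings; independent of the other rows files.
-/

namespace Summit.MatrixMultiplication.OmegaCensus

open Finset ZpZpDomino

namespace ZpZpDomino

set_option maxHeartbeats 4000000 in
/-- Row `b = 4` of the completeness check (`11⁴` lookups). [folklore] -/
theorem checkSevenRow_11_4 : checkSevenRow 11 etZ11s7 tabTreeZ11s7 4 = true := by decide +kernel

set_option maxHeartbeats 4000000 in
/-- Row `b = 5` of the completeness check (`11⁴` lookups). [folklore] -/
theorem checkSevenRow_11_5 : checkSevenRow 11 etZ11s7 tabTreeZ11s7 5 = true := by decide +kernel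

set_option maxHeartbeats 4000000 in
/-- Row `b = 6` of the completeness check (`11⁴` lookups). [folklore] -/
theorem checkSevenRow_11_6 : checkSevenRow 11 etZ11s7 tabTreeZ11s7 6 = true := by decide +kernel

set_option maxHeartbeats 4000000 in
/-- Row `b = 7` of the completeness check (`11⁴` lookups). [folklore] -/
theorem checkSevenRow_11_7 : checkSevenRow 11 etZ11s7 tabTreeZ11s7 7 = true := by decide +kernel

end ZpZpDomino

end Summit.MatrixMultiplication.OmegaCensus
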